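import Summits.AtomisticToContinuum.BoseEinsteinCondensation.Theorems.BECInfDivCoherenceGridInfDivCoherenceReTranslateNonnegOfSlack
import Summits.AtomisticToContinuum.BoseEinsteinCondensation.Theorems.BECInfDivCoherenceGridInfDivCoherenceBoostCoherenceNeg
import Summits.AtomisticToContinuum.BoseEinsteinCondensation.Theorems.BECInfDivCoherenceGridInfDivCoherenceMaxFormAddSmul
import Summits.AtomisticToContinuum.BoseEinsteinCondensation.Theorems.BECInfDivCoherenceGridInfDivCoherenceCoherenceLatticeVec
import Summits.AtomisticToContinuum.BoseEinsteinCondensation.Theorems.BECConjugateDominationHardCoreExtensionUniformTruncationGapOfSimple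
import HarnessLib

/-!
# Crux `GridInfDivCoherence` (stmt-AtomisticToContinuum-9114), line `registered`: ground-state coherence positivity is
# NECESSARY — `GridInfDivCoherence → GSPos` for every admissible `v`, hence the crux is EQUIVALENT to `GSPos ∧ Sign_gs`

Lead c5 certified that the registered sign stub `stub_groundStateGridLevySign` (Sign_gs) is implied by the crux
(`groundStateGridLevySign_of_gridInfDivCoherence`, p164928) and that, GIVEN ground-state translation-coherence
positivity (GSPos: dilute and eventually in `N`, every unit maximal-form ground state `f` has `re⟪τ_{i,u} f, f⟫ > 0`
at every particle `i` and single-particle torus shift `u`), the crux is equivalent to Sign_gs. This file closes the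
remaining gap: the crux implies GSPos too, for EVERY repulsive finite-range `v` (hard cores, `⊤`-shells and the
whole "wall class" included), so that

  `GridInfDivCoherence ↔ GSPos ∧ Sign_gs`   (`gridInfDivCoherence_iff_groundStateCoherencePos_and_sign`),

and the positivity conjunct (P) of the crux ALONE is equivalent to GSPos
(`coherencePos_nearMin_iff_groundStateCoherencePos`). In particular the line's other open stub
`stub_groundStateCoherencePos_wall` is crux-necessary as well (`groundStateCoherencePos_wall_of_gridInfDivCoherence`):
the registered skeleton of the line has no slack left in either direction.

## The argument (`reTranslate_groundState_pos_of_slack`, fixed box)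

`L > 0`, `v` repulsive finite-range, `E₀ < ⊤`, and a slack `δ > 0` such that every `δ`-near-minimising periodic `C¹`
Bose trial state `Ψ` has positive cell coherence `G_Ψ(i,r) = re ∫_{cell^N} conj Ψ(…, xᵢ + r, …) Ψ > 0` at every
`(i, r)` (this is the crux's positivity conjunct at the box). Let `f` be a unit maximal-form ground state and
`U = τ_{i, r/L}`.
* Lattice shifts `r ∈ Lℤ³`: `f` is the `L²` limit of near-minimising trial states (MaxFormApproximation,
  `GridLevySignNecessity.exists_trialStates_tendsto_groundState`) whose cell coherences at `r` are identically `1`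
  (`stub_cellCoherence_latticeVec`), so `re⟪U f, f⟫ = 1`.
* Otherwise pick a `δ'`-near-minimising trial state `Ψ₁` (`δ' = min δ 1`); its coherence `z` at `(i,r)` has
  `re z > 0`, so some Galilei boost `Ψ_m = e^{2πi m·∑ⱼxⱼ/L} Ψ₁` has `G_{Ψ_m}(i,r) = re(e^{-2πi m·r/L} z) < 0`
  (`stub_exists_boost_cellCoherence_neg`). Put `g = ι₀Ψ_m` (free embedding; Bose-symmetric, `maxForm g =
  periodicEnergy Ψ_m < ⊤` by `periodicEnergy_boost_add_le`, and `re⟪U g, g⟫ = G_{Ψ_m}(i,r) < 0` by the dictionary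
  `GridLevySignReduction.re_cellCoherence_eq`). For real `s`, `h_s = f + s g` satisfies
  `maxForm h_s ≤ E₀‖h_s‖² + 2s² maxForm g` (`stub_maxForm_add_smul_le`: parallelogram law of the maximal form +
  MaxFormBound — no first variation is needed), so for `|s| = t` small its normalisation `η` is a unit Bose-symmetric
  class with `maxForm η + d/4 ≤ E₀ + δ` (`d = δ'.toReal`), whence `re⟪U η, η⟫ ≥ 0` by the closure step
  `stub_reTranslate_nonneg_of_slack` (MaxFormApproximation + the hypothesis read back in the limit), i.e.
  `re⟪U h_s, h_s⟫ ≥ 0` for `s = ±t`. Expanding, `re⟪U f,f⟫ ± tB + t² re⟪U g,g⟫ ≥ 0`; adding the two,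
  `re⟪U f, f⟫ ≥ −t² re⟪U g, g⟫ > 0`.

References: Reed–Simon IV Thm XIII.64 [ReedSimonIV1978]; B. Simon, J. Operator Theory 1 (1979) 37–47 (maximal =
minimal form); LSSY 2005 Ch. 5 footnote 2 (boosted states) [LiebSeiringerSolovejYngvason2005].
-/

noncomputable section

namespace Summit.AtomisticToContinuum.BoseEinsteinCondensation.Theorems

open MeasureTheory Filter Literature.MathematicalPhysics.QuantumManyBody Literature.MathematicalPhysics.QuantumManyBody.BoseGas
  Literature.Analysis.FunctionSpaces
open Summit.AtomisticToContinuum.BoseEinsteinCondensation.Theses.BECInfDivCoherence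
open scoped ENNReal NNReal ComplexConjugate InnerProductSpace Topology

attribute [local instance] formDomain_measureSpace formDomain_isProbabilityMeasure
  formDomain_isProbabilityMeasure_pi comparison_isAddHaarMeasure comparison_isAddRightInvariant

/-- **Necessity of ground-state coherence positivity at a fixed box** (lead c6; assembled from the four landed stubs
`stub_reTranslate_nonneg_of_slack` p172859, `stub_exists_boost_cellCoherence_neg` p173260, `stub_maxForm_add_smul_le`
p173449, `stub_cellCoherence_latticeVec` p173520). `L > 0`, repulsive finite-range `v`, `E₀ < ⊤`; if for some slack `δ > 0` every
`δ`-near-minimising periodic trial state has positive cell coherence at every particle and shift (the positivity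
conjunct of the crux at this box), then every unit maximal-form ground state `f` has `re⟪τ_{i, r/L} f, f⟫ > 0` for all
`i`, `r`. [cite: ReedSimonIV1978, Thm XIII.64] -/
theorem reTranslate_groundState_pos_of_slack {N : ℕ} {L : ℝ} {v : ℝ → ℝ≥0∞} (hv : IsRepulsiveFiniteRange v)
    (hL : 0 < L) (hE : periodicGroundStateEnergy v N L ≠ ⊤) {δ : ℝ≥0∞} (hδ : 0 < δ)
    (hP : ∀ Ψ : PeriodicTrialState N L, periodicEnergy v Ψ ≤ periodicGroundStateEnergy v N L + δ →
      ∀ (i : Fin N) (r : EuclideanSpace ℝ (Fin 3)),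
        0 < (∫ X in cellN N L, conj (Ψ.ψ (Function.update X i (X i + r))) * Ψ.ψ X).re)
    {f : Lp ℂ 2 (volume : Measure (UnitAddTorus (Fin N × Fin 3)))} (hf : f ∈ maxFormGroundStates v N L)
    (hf1 : ‖f‖ = 1) (i : Fin N) (r : EuclideanSpace ℝ (Fin 3)) :
    0 < (⟪(Lp.compMeasurePreservingₗᵢ ℂ
        (fun t : UnitAddTorus (Fin N × Fin 3) => t + fun p : Fin N × Fin 3 =>
          (Pi.single i (toUnitTorus L r) : Fin N → UnitAddTorus (Fin 3)) p.1 p.2)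
        (measurePreserving_add_right volume _) f), f⟫_ℂ).re := by
  -- the single-particle torus translation `U = τ_{i, r/L}` on `L²((ℝ/ℤ)^{3N})`
  set U : Lp ℂ 2 (volume : Measure (UnitAddTorus (Fin N × Fin 3))) →ₗᵢ[ℂ]
      Lp ℂ 2 (volume : Measure (UnitAddTorus (Fin N × Fin 3))) :=
    Lp.compMeasurePreservingₗᵢ ℂ
        (fun t : UnitAddTorus (Fin N × Fin 3) => t + fun p : Fin N × Fin 3 =>
          (Pi.single i (toUnitTorus L r) : Fin N → UnitAddTorus (Fin 3)) p.1 p.2)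
        (measurePreserving_add_right volume _) with hU
  by_cases hr : ∃ n : Fin 3 → ℤ, r = latticeVec L n
  · -- lattice shift: the cell coherences of approximating trial states are identically `1`
    obtain ⟨n, rfl⟩ := hr
    obtain ⟨Φ, -, hconv⟩ := GridLevySignNecessity.exists_trialStates_tendsto_groundState hv hL hE hf hf1
    have hlim := GridLevySignReduction.tendsto_re_cellCoherence hL Φ f hconv i (latticeVec L n)
    have hone : Tendsto (fun k : ℕ => (∫ X in cellN N L,
        conj ((Φ k).ψ (Function.update X i (X i + latticeVec L n))) * (Φ k).ψ X).re) atTop (𝓝 (1 : ℝ)) := by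
      simp_rw [stub_cellCoherence_latticeVec N L _ i n]
      exact tendsto_const_nhds
    have h1 := tendsto_nhds_unique hlim hone
    rw [h1]
    exact one_pos
  · -- non-lattice shift: the boosted-perturbation argument
    -- a finite slack `δ' ≤ δ`
    set δ' : ℝ≥0∞ := min δ 1 with hδ'def
    have hδ' : 0 < δ' := lt_min hδ one_pos
    have hδ'top : δ' ≠ ⊤ := ne_top_of_le_ne_top ENNReal.one_ne_top (min_le_right _ _)
    have hδ'le : δ' ≤ δ := min_le_left _ _
    -- a `δ'`-near-minimising trial state `Ψ₁`
    have hlt : periodicGroundStateEnergy v N L < periodicGroundStateEnergy v N L + δ' :=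
      ENNReal.lt_add_right hE hδ'.ne'
    obtain ⟨Ψ₁, hΨ₁⟩ : ∃ Ψ₁ : PeriodicTrialState N L,
        periodicEnergy v Ψ₁ < periodicGroundStateEnergy v N L + δ' := by
      unfold periodicGroundStateEnergy at hlt ⊢
      exact iInf_lt_iff.mp hlt
    have hΨ₁δ : periodicEnergy v Ψ₁ ≤ periodicGroundStateEnergy v N L + δ :=
      hΨ₁.le.trans (add_le_add le_rfl hδ'le)
    -- its coherence at `(i, r)` is positive, so some boost has negative coherence there
    have hz : 0 < (∫ X in cellN N L, conj (Ψ₁.ψ (Function.update X i (X i + r))) * Ψ₁.ψ X).re :=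
      hP Ψ₁ hΨ₁δ i r
    obtain ⟨m, hm⟩ := stub_exists_boost_cellCoherence_neg N L hL Ψ₁ i r hr hz
    set Ψm : PeriodicTrialState N L := Ψ₁.boost hL m with hΨm
    -- the free-embedded class `g = ι₀ Ψm`
    set g : Lp ℂ 2 (volume : Measure (UnitAddTorus (Fin N × Fin 3))) :=
      formEmbed hL Cruxes.StaticResponseBound.UvThomsonForceWave.measurable_zeroProfile
        (Cruxes.StaticResponseBound.UvThomsonForceWave.lintegral_periodicInteraction_zero_ne_top N L)
        ⟨graphEmbed hL Cruxes.StaticResponseBound.UvThomsonForceWave.measurable_zeroProfile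
          (Cruxes.StaticResponseBound.UvThomsonForceWave.lintegral_periodicInteraction_zero_ne_top N L)
          ⟨Ψm.ψ, Ψm.mem_periodicCore⟩, graphEmbed_mem_formDomain _ _ _ _⟩ with hgdef
    have hgsymm : g ∈ boseSymmetric N := formEmbed_graphEmbed_mem_boseSymmetric hL _ _ _
    have hgQ : maxForm v L g = periodicEnergy v Ψm :=
      Cruxes.HardCoreExtension.ThirdLawCurrentFloorAlt.maxForm_formEmbed_free_trialState hL hv.1 Ψm
    have hEmfin : periodicEnergy v Ψm ≠ ⊤ := by
      have hb := Literature.Barriers.AtomisticToContinuum.BoseGas.periodicEnergy_boost_add_le hL v m Ψ₁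
      have hfin1 : periodicEnergy v Ψ₁ ≠ ⊤ :=
        ne_top_of_lt (hΨ₁.trans_le (le_top))
      have hrhs : 2 * periodicEnergy v Ψ₁ + 2 * ((N : ℝ≥0∞) * ENNReal.ofReal
          (Literature.Barriers.AtomisticToContinuum.BoseGas.boostGap L m)) ≠ ⊤ := by
        have hE1 : periodicEnergy v Ψ₁ ≠ ⊤ := ne_top_of_lt hΨ₁
        apply ENNReal.add_ne_top.2
        refine ⟨ENNReal.mul_ne_top (by simp) hE1, ENNReal.mul_ne_top (by simp) ?_⟩
        exact ENNReal.mul_ne_top (ENNReal.natCast_ne_top N) ENNReal.ofReal_ne_top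
      exact ne_top_of_le_ne_top hrhs ((self_le_add_right _ _).trans hb)
    have hgfin : maxForm v L g ≠ ⊤ := by rwa [hgQ]
    -- `re⟪U g, g⟫ < 0` (dictionary: it is the cell coherence of `Ψm` at `(i, r)`)
    have hC : (⟪U g, g⟫_ℂ).re < 0 := by
      rw [hU, hgdef, ← GridLevySignReduction.re_cellCoherence_eq hL Ψm i r]
      exact hm
    -- the perturbed states `h_s = f + s g`
    have hfsymm : f ∈ boseSymmetric N := hf.1
    -- expansion of the amplitude along the real line through `f` in direction `g`
    have hexp : ∀ s : ℝ, (⟪U (f + (s : ℂ) • g), f + (s : ℂ) • g⟫_ℂ).re =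
        (⟪U f, f⟫_ℂ).re + s * ((⟪U f, g⟫_ℂ).re + (⟪U g, f⟫_ℂ).re) + s ^ 2 * (⟪U g, g⟫_ℂ).re := by
      intro s
      simp only [map_add, map_smul, inner_add_left, inner_add_right, inner_smul_left, inner_smul_right,
        Complex.conj_ofReal, Complex.add_re, Complex.re_ofReal_mul]
      ring
    -- the energy of the normalised perturbed state is within the slack for small `|s|`
    set Qg : ℝ := (maxForm v L g).toReal with hQgdef
    have hQg : 0 ≤ Qg := ENNReal.toReal_nonneg
    set d : ℝ := δ'.toReal with hddef
    have hd : 0 < d := ENNReal.toReal_pos hδ'.ne' hδ'top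
    set t : ℝ := min (min (1 / (2 * (‖g‖ + 1))) (d / (32 * (Qg + 1)))) 1 with htdef
    have ht : 0 < t := by positivity
    have ht1 : t ≤ 1 := min_le_right _ _
    have htg : t ≤ 1 / (2 * (‖g‖ + 1)) := (min_le_left _ _).trans (min_le_left _ _)
    have htd : t ≤ d / (32 * (Qg + 1)) := (min_le_left _ _).trans (min_le_right _ _)
    have htsq : t ^ 2 ≤ d / (32 * (Qg + 1)) := by nlinarith
    -- for `s = ±t`: the amplitude of `h_s` is non-negative
    have hkey : ∀ s : ℝ, |s| = t → 0 ≤ (⟪U (f + (s : ℂ) • g), f + (s : ℂ) • g⟫_ℂ).re := by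
      intro s hs
      set h : Lp ℂ 2 (volume : Measure (UnitAddTorus (Fin N × Fin 3))) := f + (s : ℂ) • g with hhdef
      -- norm of `h` from below
      have hsg : ‖(s : ℂ) • g‖ ≤ 1 / 2 := by
        rw [norm_smul, Complex.norm_real, Real.norm_eq_abs, hs]
        have h2 : t * (‖g‖ + 1) ≤ 1 / 2 := by
          rw [le_div_iff₀ (by positivity)] at htg
          linarith
        nlinarith [norm_nonneg g]
      have hhnorm : 1 / 2 ≤ ‖h‖ := by
        have h1 : ‖f‖ - ‖(s : ℂ) • g‖ ≤ ‖f + (s : ℂ) • g‖ := by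
          have := norm_sub_norm_le f (-( (s : ℂ) • g))
          rw [sub_neg_eq_add, norm_neg] at this
          linarith [abs_sub_abs_le_abs_sub ‖f‖ ‖(s:ℂ) • g‖, norm_sub_le f (-( (s : ℂ) • g))]
        rw [hhdef]
        linarith
      have hhpos : 0 < ‖h‖ := lt_of_lt_of_le (by norm_num) hhnorm
      have hhsymm : h ∈ boseSymmetric N := (boseSymmetric N).add_mem hfsymm ((boseSymmetric N).smul_mem _ hgsymm)
      -- maximal form of `h`
      have hQh : maxForm v L h ≤ periodicGroundStateEnergy v N L * ENNReal.ofReal (‖h‖ ^ 2) +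
          2 * ENNReal.ofReal (s ^ 2) * maxForm v L g :=
        stub_maxForm_add_smul_le N L v hv hL hE f hf hf1 g hgsymm hgfin s
      -- the normalised state
      set c : ℝ := ‖h‖⁻¹ with hcdef
      have hc : 0 < c := inv_pos.2 hhpos
      set η : Lp ℂ 2 (volume : Measure (UnitAddTorus (Fin N × Fin 3))) := (c : ℂ) • h with hηdef
      have hη1 : ‖η‖ = 1 := by
        rw [hηdef, norm_smul, Complex.norm_real, Real.norm_eq_abs, abs_of_pos hc, hcdef,
          inv_mul_cancel₀ hhpos.ne']
      have hηsymm : η ∈ boseSymmetric N := (boseSymmetric N).smul_mem _ hhsymm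
      have hcsq : ‖(c : ℂ)‖ ^ 2 * ‖h‖ ^ 2 = 1 := by
        rw [Complex.norm_real, Real.norm_eq_abs, abs_of_pos hc, hcdef, ← mul_pow, inv_mul_cancel₀ hhpos.ne',
          one_pow]
      have hQη : maxForm v L η ≤ periodicGroundStateEnergy v N L +
          ENNReal.ofReal (c ^ 2) * (2 * ENNReal.ofReal (s ^ 2) * maxForm v L g) := by
        rw [hηdef, maxForm_smul]
        calc ENNReal.ofReal (‖(c : ℂ)‖ ^ 2) * maxForm v L h
            ≤ ENNReal.ofReal (‖(c : ℂ)‖ ^ 2) * (periodicGroundStateEnergy v N L * ENNReal.ofReal (‖h‖ ^ 2) +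
                2 * ENNReal.ofReal (s ^ 2) * maxForm v L g) := by gcongr
          _ = periodicGroundStateEnergy v N L * (ENNReal.ofReal (‖(c : ℂ)‖ ^ 2 * ‖h‖ ^ 2)) +
                ENNReal.ofReal (‖(c : ℂ)‖ ^ 2) * (2 * ENNReal.ofReal (s ^ 2) * maxForm v L g) := by
              rw [ENNReal.ofReal_mul (by positivity)]; ring
          _ = _ := by
              rw [hcsq, ENNReal.ofReal_one, mul_one, Complex.norm_real, Real.norm_eq_abs, abs_of_pos hc]
      -- the error term is at most `d/4`
      have hc2 : c ^ 2 ≤ 4 := by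
        have : c ≤ 2 := by
          rw [hcdef]
          calc ‖h‖⁻¹ ≤ (1 / 2)⁻¹ := by
                exact inv_anti₀ (by norm_num) hhnorm
            _ = 2 := by norm_num
        nlinarith
      have herr : ENNReal.ofReal (c ^ 2) * (2 * ENNReal.ofReal (s ^ 2) * maxForm v L g) ≤
          ENNReal.ofReal (d / 4) := by
        have hs2 : s ^ 2 = t ^ 2 := by rw [← sq_abs, hs]
        rw [hs2, ← ENNReal.ofReal_toReal hgfin, ← hQgdef, ← ENNReal.ofReal_ofNat 2,
          ← ENNReal.ofReal_mul (by norm_num), ← ENNReal.ofReal_mul (by positivity),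
          ← ENNReal.ofReal_mul (by positivity)]
        refine ENNReal.ofReal_le_ofReal ?_
        have h32 : t ^ 2 * (32 * (Qg + 1)) ≤ d := by
          rwa [le_div_iff₀ (by positivity)] at htsq
        nlinarith
      have hmargin : maxForm v L η + ENNReal.ofReal (d / 4) ≤ periodicGroundStateEnergy v N L + δ := by
        calc maxForm v L η + ENNReal.ofReal (d / 4)
            ≤ periodicGroundStateEnergy v N L + ENNReal.ofReal (d / 4) + ENNReal.ofReal (d / 4) :=
              add_le_add (hQη.trans (add_le_add le_rfl herr)) le_rfl
          _ = periodicGroundStateEnergy v N L + ENNReal.ofReal (d / 4 + d / 4) := by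
              rw [add_assoc, ← ENNReal.ofReal_add (by positivity) (by positivity)]
          _ ≤ periodicGroundStateEnergy v N L + δ' := by
              gcongr
              rw [hddef]
              calc ENNReal.ofReal (δ'.toReal / 4 + δ'.toReal / 4) ≤ ENNReal.ofReal δ'.toReal :=
                    ENNReal.ofReal_le_ofReal (by linarith [hd])
                _ = δ' := ENNReal.ofReal_toReal hδ'top
          _ ≤ periodicGroundStateEnergy v N L + δ := add_le_add le_rfl hδ'le
      have hηfin : maxForm v L η ≠ ⊤ :=
        ne_top_of_le_ne_top (ENNReal.add_ne_top.2 ⟨hE, ENNReal.mul_ne_top ENNReal.ofReal_ne_top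
          (ENNReal.mul_ne_top (ENNReal.mul_ne_top (by simp) ENNReal.ofReal_ne_top) hgfin)⟩) hQη
      -- the closure step applied to `η`
      have hηnn : 0 ≤ (⟪U η, η⟫_ℂ).re :=
        stub_reTranslate_nonneg_of_slack N L v hv hL δ i r (fun Ψ hΨ => hP Ψ hΨ i r) η hηsymm hη1 hηfin
          (d / 4) (by positivity) hmargin
      -- undo the normalisation
      have hscale : (⟪U η, η⟫_ℂ).re = c ^ 2 * (⟪U h, h⟫_ℂ).re := by
        rw [hηdef, map_smul, inner_smul_left, inner_smul_right, Complex.conj_ofReal, ← mul_assoc,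
          ← Complex.ofReal_mul, Complex.re_ofReal_mul, sq]
      rw [hscale] at hηnn
      exact nonneg_of_mul_nonneg_right (by rwa [mul_comm] at hηnn) (by positivity)
    -- combine `s = t` and `s = -t`
    have hplus := hkey t (abs_of_pos ht)
    have hminus := hkey (-t) (by rw [abs_neg, abs_of_pos ht])
    rw [hexp] at hplus hminus
    have hneg : 0 < t ^ 2 * (-(⟪U g, g⟫_ℂ).re) := mul_pos (pow_pos ht 2) (neg_pos.2 hC)
    nlinarith [hplus, hminus, hneg]


/-- **Necessity of ground-state coherence positivity** (lead c6): the crux `GridInfDivCoherence` IMPLIES ground-state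
translation-coherence positivity for EVERY repulsive finite-range `v` — dilute and eventually in `N`, every unit
maximal-form ground state has `re⟪τ_{i,u} f, f⟫ > 0` at every particle `i` and every single-particle torus shift `u`
(`ρ₀` from the crux and Ruelle finiteness; at a large `N` the crux's positivity conjunct with `ε := 1` is the slack
hypothesis of `reTranslate_groundState_pos_of_slack`; every `u` is `r/L mod ℤ³`, `toUnitTorus_fromUnitTorus`).
[cite: ReedSimonIV1978, Thm XIII.64] -/
theorem groundStateCoherencePos_of_gridInfDivCoherence :
    GridInfDivCoherence → ∀ v : ℝ → ℝ≥0∞, IsRepulsiveFiniteRange v →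
      ∃ ρ₀ : ℝ, 0 < ρ₀ ∧ ∀ ρ : ℝ, 0 < ρ → ρ < ρ₀ → ∀ᶠ N : ℕ in atTop,
        ∀ f : Lp ℂ 2 (volume : Measure (UnitAddTorus (Fin N × Fin 3))),
          f ∈ maxFormGroundStates v N (sideLength ρ N) → ‖f‖ = 1 →
            ∀ (i : Fin N) (u : UnitAddTorus (Fin 3)),
              0 < (⟪(Lp.compMeasurePreservingₗᵢ ℂ
                  (fun t : UnitAddTorus (Fin N × Fin 3) => t + fun p : Fin N × Fin 3 =>
                    (Pi.single i u : Fin N → UnitAddTorus (Fin 3)) p.1 p.2)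
                  (measurePreserving_add_right volume _) f), f⟫_ℂ).re := by
  intro hG v hv
  obtain ⟨η, -, ρ₀, hρ₀, hcrux⟩ := hG v hv
  obtain ⟨ρF, hρF, hfin⟩ :=
    Literature.Barriers.AtomisticToContinuum.BoseGas.exists_eventually_periodicGroundStateEnergy_lt_top hv
  refine ⟨min ρ₀ ρF, lt_min hρ₀ hρF, fun ρ hρ hρlt => ?_⟩
  filter_upwards [hcrux ρ hρ (hρlt.trans_le (min_le_left _ _)), hfin ρ hρ (hρlt.trans_le (min_le_right _ _)),
    (tendsto_sideLength_atTop hρ).eventually_gt_atTop 0] with N hN hEN hL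
  intro f hf hf1 i u
  obtain ⟨δ, hδ, hslack⟩ := hN 1 one_pos
  have hu : toUnitTorus (sideLength ρ N) (fromUnitTorus (sideLength ρ N) u) = u :=
    toUnitTorus_fromUnitTorus hL.ne' u
  rw [← hu]
  exact reTranslate_groundState_pos_of_slack hv hL hEN.ne hδ (fun Ψ hΨ i' r' => (hslack Ψ hΨ i').1 r')
    hf hf1 i _

/-- **The wall stub is NECESSARY** (lead c6): `GridInfDivCoherence → stub_groundStateCoherencePos_wall` (verbatim the
registered signature; the wall-class hypotheses are not even used). Together with lead c5's
`groundStateGridLevySign_of_gridInfDivCoherence` (crux → Sign_gs, p164928) the two open stubs of this skeleton are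
each crux-necessary, and jointly crux-EQUIVALENT (`gridInfDivCoherence_iff_groundStateCoherencePos_and_sign`).
[cite: ReedSimonIV1978, Thm XIII.64] -/
theorem groundStateCoherencePos_wall_of_gridInfDivCoherence (hG : GridInfDivCoherence) :
    ∀ v : ℝ → ℝ≥0∞, IsRepulsiveFiniteRange v → (∫⁻ x : Space, v ‖x‖) = ⊤ →
      (∀ w : ℝ → ℝ≥0∞, IsRepulsiveFiniteRange w → (∀ᵐ x : Space, v ‖x‖ = w ‖x‖) →
        ¬ ∀ δ : ℝ, 0 < δ → ∃ M : ℝ≥0∞, M ≠ ⊤ ∧ ∀ r : ℝ, δ < r → w r ≤ M) →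
      ∃ ρ₀ : ℝ, 0 < ρ₀ ∧ ∀ ρ : ℝ, 0 < ρ → ρ < ρ₀ → ∀ᶠ N : ℕ in atTop,
        ∀ f : Lp ℂ 2 (volume : Measure (UnitAddTorus (Fin N × Fin 3))),
          f ∈ maxFormGroundStates v N (sideLength ρ N) → ‖f‖ = 1 →
            ∀ (i : Fin N) (u : UnitAddTorus (Fin 3)),
              0 < (⟪(Lp.compMeasurePreservingₗᵢ ℂ
                  (fun t : UnitAddTorus (Fin N × Fin 3) => t + fun p : Fin N × Fin 3 =>
                    (Pi.single i u : Fin N → UnitAddTorus (Fin 3)) p.1 p.2)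
                  (measurePreserving_add_right volume _) f), f⟫_ℂ).re :=
  fun v hv _ _ => groundStateCoherencePos_of_gridInfDivCoherence hG v hv

/-- **The crux is EQUIVALENT to (ground-state coherence positivity) ∧ (exact ground-state grid infinite
divisibility)** (lead c6): `GridInfDivCoherence ↔ GSPos ∧ Sign_gs`, where GSPos is the conclusion of
`groundStateCoherencePos` for every admissible `v` and Sign_gs is `stub_groundStateGridLevySign`. `→`:
`groundStateCoherencePos_of_gridInfDivCoherence` (this file) and `groundStateGridLevySign_of_gridInfDivCoherence`
(lead c5, p164928); `←`: lead c5's `gridInfDivCoherence_iff_groundStateGridLevySign_of_pos`. So the line's two open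
stubs carry no slack in either direction: the crux as filed IS "positivity of the translation coherence of every
dilute ground state (all admissible `v`, wall class included) and non-negativity of its non-trivial grid Lévy
weights". [cite: ReedSimonIV1978, Thm XIII.64] -/
theorem gridInfDivCoherence_iff_groundStateCoherencePos_and_sign :
    GridInfDivCoherence ↔
    ((∀ v : ℝ → ℝ≥0∞, IsRepulsiveFiniteRange v →
      ∃ ρ₀ : ℝ, 0 < ρ₀ ∧ ∀ ρ : ℝ, 0 < ρ → ρ < ρ₀ → ∀ᶠ N : ℕ in atTop,
        ∀ f : Lp ℂ 2 (volume : Measure (UnitAddTorus (Fin N × Fin 3))),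
          f ∈ maxFormGroundStates v N (sideLength ρ N) → ‖f‖ = 1 →
            ∀ (i : Fin N) (u : UnitAddTorus (Fin 3)),
              0 < (⟪(Lp.compMeasurePreservingₗᵢ ℂ
                  (fun t : UnitAddTorus (Fin N × Fin 3) => t + fun p : Fin N × Fin 3 =>
                    (Pi.single i u : Fin N → UnitAddTorus (Fin 3)) p.1 p.2)
                  (measurePreserving_add_right volume _) f), f⟫_ℂ).re) ∧
    (∀ v : ℝ → ℝ≥0∞, IsRepulsiveFiniteRange v → ∃ η : ℝ, 0 < η ∧ ∃ ρ₀ : ℝ, 0 < ρ₀ ∧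
      ∀ ρ : ℝ, 0 < ρ → ρ < ρ₀ → ∀ᶠ N : ℕ in atTop,
        ∀ f : Lp ℂ 2 (volume : Measure (UnitAddTorus (Fin N × Fin 3))),
          f ∈ maxFormGroundStates v N (sideLength ρ N) → ‖f‖ = 1 → ∀ i : Fin N,
            (∀ r : EuclideanSpace ℝ (Fin 3), 0 < (⟪(Lp.compMeasurePreservingₗᵢ ℂ
                (fun t : UnitAddTorus (Fin N × Fin 3) => t + fun p : Fin N × Fin 3 =>
                  (Pi.single i (toUnitTorus (sideLength ρ N) r) : Fin N → UnitAddTorus (Fin 3)) p.1 p.2)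
                (measurePreserving_add_right volume _) f), f⟫_ℂ).re) →
            ∀ q : Fin 3 → Fin ⌊sideLength ρ N / η⌋₊, (∃ k, (q k : ℕ) ≠ 0) →
              0 ≤ (∑ j : Fin 3 → Fin ⌊sideLength ρ N / η⌋₊,
                Real.log ((⟪(Lp.compMeasurePreservingₗᵢ ℂ
                  (fun t : UnitAddTorus (Fin N × Fin 3) => t + fun p : Fin N × Fin 3 =>
                    (Pi.single i (toUnitTorus (sideLength ρ N)
                      (latticeVec (sideLength ρ N / ⌊sideLength ρ N / η⌋₊) (fun k => ((j k : ℕ) : ℤ)))) :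
                      Fin N → UnitAddTorus (Fin 3)) p.1 p.2)
                  (measurePreserving_add_right volume _) f), f⟫_ℂ).re) *
                  Real.cos (2 * Real.pi * (∑ k, ((q k : ℕ) : ℝ) * ((j k : ℕ) : ℝ)) / ⌊sideLength ρ N / η⌋₊)) /
                ((⌊sideLength ρ N / η⌋₊ : ℕ) : ℝ) ^ 3)) := by
  constructor
  · intro hG
    exact ⟨groundStateCoherencePos_of_gridInfDivCoherence hG,
      groundStateGridLevySign_of_gridInfDivCoherence hG⟩
  · rintro ⟨hPos, hSign⟩
    exact (gridInfDivCoherence_iff_groundStateGridLevySign_of_pos hPos).2 hSign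

/-- **The positivity conjunct (P) of the crux is EQUIVALENT to ground-state coherence positivity** (lead c6). For
every repulsive finite-range `v`: (dilute, eventually in `N`, some `δ > 0` makes every `δ`-near-minimising trial state
have `G_Ψ(i,r) > 0` for all `i, r`) ↔ (dilute, eventually in `N`, every unit maximal-form ground state has
`re⟪τ_{i,u} f, f⟫ > 0` for all `i, u`). `→`: `reTranslate_groundState_pos_of_slack` with Ruelle finiteness; `←`: lead
c4's `stub_coherencePos_of_groundStates` (p161669). So the (P)-side residue GSPos_wall of the line is exactly the
content of (P) on the wall class. [cite: ReedSimonIV1978, Thm XIII.64] -/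
theorem coherencePos_nearMin_iff_groundStateCoherencePos :
    (∀ v : ℝ → ℝ≥0∞, IsRepulsiveFiniteRange v →
      ∃ ρ₀ : ℝ, 0 < ρ₀ ∧ ∀ ρ : ℝ, 0 < ρ → ρ < ρ₀ → ∀ᶠ N : ℕ in atTop, ∃ δ : ℝ≥0∞, 0 < δ ∧
        ∀ Ψ : PeriodicTrialState N (sideLength ρ N),
          periodicEnergy v Ψ ≤ periodicGroundStateEnergy v N (sideLength ρ N) + δ → ∀ i : Fin N,
            ∀ r, 0 < (∫ X in cellN N (sideLength ρ N),
              conj (Ψ.ψ (Function.update X i (X i + r))) * Ψ.ψ X).re) ↔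
    (∀ v : ℝ → ℝ≥0∞, IsRepulsiveFiniteRange v →
      ∃ ρ₀ : ℝ, 0 < ρ₀ ∧ ∀ ρ : ℝ, 0 < ρ → ρ < ρ₀ → ∀ᶠ N : ℕ in atTop,
        ∀ f : Lp ℂ 2 (volume : Measure (UnitAddTorus (Fin N × Fin 3))),
          f ∈ maxFormGroundStates v N (sideLength ρ N) → ‖f‖ = 1 →
            ∀ (i : Fin N) (u : UnitAddTorus (Fin 3)),
              0 < (⟪(Lp.compMeasurePreservingₗᵢ ℂ
                  (fun t : UnitAddTorus (Fin N × Fin 3) => t + fun p : Fin N × Fin 3 =>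
                    (Pi.single i u : Fin N → UnitAddTorus (Fin 3)) p.1 p.2)
                  (measurePreserving_add_right volume _) f), f⟫_ℂ).re) := by
  refine ⟨fun hP v hv => ?_, stub_coherencePos_of_groundStates⟩
  obtain ⟨ρ₀, hρ₀, hPv⟩ := hP v hv
  obtain ⟨ρF, hρF, hfin⟩ :=
    Literature.Barriers.AtomisticToContinuum.BoseGas.exists_eventually_periodicGroundStateEnergy_lt_top hv
  refine ⟨min ρ₀ ρF, lt_min hρ₀ hρF, fun ρ hρ hρlt => ?_⟩
  filter_upwards [hPv ρ hρ (hρlt.trans_le (min_le_left _ _)), hfin ρ hρ (hρlt.trans_le (min_le_right _ _)),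
    (tendsto_sideLength_atTop hρ).eventually_gt_atTop 0] with N hN hEN hL
  intro f hf hf1 i u
  obtain ⟨δ, hδ, hslack⟩ := hN
  have hu : toUnitTorus (sideLength ρ N) (fromUnitTorus (sideLength ρ N) u) = u :=
    toUnitTorus_fromUnitTorus hL.ne' u
  rw [← hu]
  exact reTranslate_groundState_pos_of_slack hv hL hEN.ne hδ hslack hf hf1 i _

end Summit.AtomisticToContinuum.BoseEinsteinCondensation.Theorems

end
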